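import Summits.SmoothPoincare4.SmoothPoincare4.Theorems.EntropyRungMargerinRailsDefs
import Summits.SmoothPoincare4.SmoothPoincare4.Theorems.EntropyRungChangGurskyYangStubMaximalFlow
import Summits.SmoothPoincare4.SmoothPoincare4.Theorems.EntropyRungChangGurskyYangStubInvariantPinching
import Summits.SmoothPoincare4.SmoothPoincare4.Theorems.EntropyRungChangGurskyYangStubGradientEstimates
import Summits.SmoothPoincare4.SmoothPoincare4.Theorems.EntropyRungChangGurskyYangStubCurvatureRatio
import Summits.SmoothPoincare4.SmoothPoincare4.Theorems.EntropyRungChangGurskyYangStubRoundnessRate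
import Summits.SmoothPoincare4.SmoothPoincare4.Theorems.EntropyRungChangGurskyYangStubScaledShi
import Summits.SmoothPoincare4.SmoothPoincare4.Theorems.EntropyRungChangGurskyYangStubSmoothRoundLimit
import Summits.SmoothPoincare4.SmoothPoincare4.Theorems.EntropyRungChangGurskyYangOfBlowupLimit
import Summits.SmoothPoincare4.SmoothPoincare4.Theorems.EntropyRungChangGurskyYangOfThreeFacts
import Summits.SmoothPoincare4.SmoothPoincare4.Theorems.EntropyRungChangGurskyYangOfClassicalFacts
import Literature.Geometry.Riemannian.ChernGaussBonnetFourProofs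
import Literature.Geometry.Riemannian.HamiltonConvergenceCriterion
import HarnessLib

/-!
# Route EntropyRung · crux `ChangGurskyYang` — the flow leaf is CLOSED: Hamilton's convergence criterion
# 5.2 in dimension four is a theorem of the tree, and the crux holds modulo the TWO Gursky–Viaclovsky facts

Skeleton r15 of line `margerin-cone-hamilton-rails` (continuation lead c6, crux stmt-SmoothPoincare4-10834).
The five Hamilton-1982 stubs of the flow leaf (reshape r12, lead c5) have ALL LANDED:
`stub_gradientEstimates` (p128193: Thm. 11.1 + Lemma 17.4), `stub_curvatureRatio` (p126761: Thm. 15.1),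
`stub_roundnessRate` (p127038: §16–17 Type-I sandwich and roundness rate), `stub_scaledShi` (p126273: Shi for one
Type-I flow), `stub_smoothRoundLimit` (§14 Lemma 14.2 + §17: smooth convergence of `g/(T−t)` to a round metric,
assembled from eight landed layers). Together with `stub_maximalFlow` (p110641) and `stub_invariantPinching`
(p110603) they prove, WITHOUT any named fact:

* `constantCurvature_of_pinchedFlows_rails` — a `β`-pinched Ricci flow on a closed connected 4-manifold yields a
  `C^∞` Riemannian metric of constant sectional curvature `k > 0` (the skeleton's `stub_pinchedFlowConvergence`,
  Theorems-side and fact-free);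
* `hamilton_convergenceCriterion_four_holds` — **the Literature named fact
  `Literature.Geometry.Riemannian.hamilton_convergenceCriterion_four` (Hamilton 1986, §5, 5.2 Convergence
  criterion, vended form) HOLDS**, via the exponent reduction `mem_pinchingSet_of_hamiltonSet` (p113080);
* `ChangGurskyYang_of_twoFacts` — the crux from the TWO remaining one-fact leaves, Gursky–Viaclovsky openness and
  closedness of the Weyl-weighted `σ₂` path (`changGurskyYang_theorem14_four_of_twoGvFacts`, p124403, feeds CGY
  Thm. 1.4; Chern–Gauss–Bonnet is `chernGaussBonnet_four_holds`; composition `ChangGurskyYang_of_classicalFacts`,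
  p88196), with its `WeylBudget` and `changGurskyYang_sphere_four` forms.

No `sorry`, no definition, no named-fact hypothesis besides the two GV facts in the last three theorems.

## References

* R. S. Hamilton, *Four-manifolds with positive curvature operator*, J. Differential Geom. 24 (1986) 153–179,
  §5, 5.2 (p. 164). [Hamilton1986]
* R. S. Hamilton, *Three-manifolds with positive Ricci curvature*, J. Differential Geom. 17 (1982) 255–306,
  §§11–17. [Hamilton1982]
* C. Margerin, *A sharp characterization of the smooth 4-sphere in curvature terms*, Comm. Anal. Geom. 6
  (1998) 21–65, Part VI. [Margerin1998]
* S.-Y. A. Chang, M. J. Gursky, P. C. Yang, *A conformally invariant sphere theorem in four dimensions*,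
  Publ. Math. IHÉS 98 (2003) 105–143, Thm. A, §2. [ChangGurskyYang2003]
-/

noncomputable section

-- every `Summit.SmoothPoincare4.SmoothPoincare4.…` name repeats the summit = sub-problem segment (D-0017 layout)
set_option linter.dupNamespace false

open Set Function Filter
open scoped Manifold ContDiff Topology

namespace Summit.SmoothPoincare4.SmoothPoincare4.Theorems.MargerinRails

open Literature.Geometry.Riemannian
open Literature.Geometry.Lorentzian Literature.Geometry.Lorentzian.PseudoRiemannianMetric
open Summit.SmoothPoincare4.SmoothPoincare4.Theses.EntropyRung (ChangGurskyYang)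

/-- **A pinched Ricci flow on a closed connected 4-manifold yields a metric of constant sectional curvature
`k > 0` — FACT-FREE** (Hamilton 1986, §5, criterion 5.2 for the sets `pinchingSet m c K τ`, `0 < τ ≤ 1`,
proved along Hamilton's own 1982 route on the fixed manifold: `stub_maximalFlow` → `stub_invariantPinching` →
`stub_gradientEstimates` → `stub_curvatureRatio` → `stub_roundnessRate` → `stub_scaledShi` →
`stub_smoothRoundLimit`, all landed). This is the skeleton's `stub_pinchedFlowConvergence` verbatim, Theorems-side.
[cite: Hamilton1986, §5, 5.2 (p. 164)] [cite: Hamilton1982, §§11–17] [cite: Margerin1998, Part VI, pp. 53–57] -/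
theorem constantCurvature_of_pinchedFlows_rails
    (M : Type) [TopologicalSpace M] [T2Space M] [SecondCountableTopology M]
    [ChartedSpace (EuclideanSpace ℝ (Fin 4)) M] [IsManifold (𝓡 4) ∞ M] [CompactSpace M]
    [ConnectedSpace M]
    (g₀ : PseudoRiemannianMetric (𝓡 4) ∞ (EuclideanSpace ℝ (Fin 4)) (TangentSpace (𝓡 4) : M → Type _))
    (m c K τ : ℝ) (hg₀ : g₀.IsRiemannian) (hm : 0 < m) (hK : 0 < K) (hτ0 : 0 < τ) (hτ1 : τ ≤ 1)
    (hflows : ∀ (T : ℝ)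
        (g : ℝ → PseudoRiemannianMetric (𝓡 4) ∞ (EuclideanSpace ℝ (Fin 4))
          (TangentSpace (𝓡 4) : M → Type _))
        (cov : ℝ → CovariantDerivative (𝓡 4) (EuclideanSpace ℝ (Fin 4))
          (TangentSpace (𝓡 4) : M → Type _)),
        IsRicciFlow g cov (Ico 0 T) → (∀ t ∈ Ico 0 T, (g t).IsRiemannian) → g 0 = g₀ →
        ∀ t ∈ Ico 0 T, ∀ (x : M) (e : Fin 4 → TangentSpace (𝓡 4) x),
          (g t).IsOrthonormalFrame x e →
            ((g t).blockA (cov t) x e, (g t).blockB (cov t) x e, (g t).blockC (cov t) x e) ∈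
              pinchingSet m c K τ) :
    ∃ (k : ℝ) (g' : PseudoRiemannianMetric (𝓡 4) ∞ (EuclideanSpace ℝ (Fin 4))
        (TangentSpace (𝓡 4) : M → Type _)),
      0 < k ∧ g'.IsRiemannian ∧ g'.HasConstantSectionalCurvature k := by
  -- 4a: the maximal flow from `g₀` is finite-time
  obtain ⟨T, g, cov, hmax, h0⟩ := stub_maximalFlow M g₀ m c K τ hg₀ hm hflows
  have hT : 0 < T := hmax.pos
  -- 4b: the pinching along the maximal flow, in invariant form
  have hpinch : ∀ s ∈ Ico 0 T, ∀ [(g s).HasLeviCivita] (x : M),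
      m ≤ (g s).scalarCurvature x ∧
        (g s).weylNormSq x + 2 * (g s).tracelessRicciNormSq x ≤
          K * (g s).scalarCurvature x ^ (2 - τ) := by
    intro s hs _ x
    exact stub_invariantPinching M (g s) (cov s) m c K τ (hmax.isRiemannian s hs)
      (hmax.isRicciFlow.isLeviCivita s hs)
      (fun y e he ↦ hflows T g cov hmax.isRicciFlow hmax.isRiemannian h0 s hs y e he) x
  -- 4.B1: the gradient estimate (Thm. 11.1) and the gradient decay (Lemma 17.4)
  obtain ⟨hgrad, hdecay⟩ := stub_gradientEstimates M g cov T m K τ hT hm hK hτ0 hτ1 hmax.isRicciFlow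
    hmax.isRiemannian hpinch
  -- 4.B2: `R_max / R_min → 1`
  have hratio := stub_curvatureRatio M g cov T m K τ hm hK hτ0 hτ1 hmax hpinch hgrad
  -- 4.B3: Type-I bounds and the roundness rate
  obtain ⟨δ, C, t₀, hδ, -, ht₀, hround⟩ :=
    stub_roundnessRate M g cov T m K τ hm hK hτ0 hτ1 hmax hpinch hdecay hratio
  -- 4.B4: scaled Shi bounds for this one flow
  have hshi := stub_scaledShi M g cov T hT hmax.isRicciFlow hmax.isRiemannian C t₀ ht₀
    (fun t ht x ↦ (hround t ht x).2.2.2)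
  -- 4.B5: smooth convergence of `g(t)/(T−t)` to a round metric
  exact stub_smoothRoundLimit M g cov T hT hmax.isRicciFlow hmax.isRiemannian δ C t₀ hδ ht₀
    (fun t ht x ↦ ⟨(hround t ht x).1, (hround t ht x).2.1, (hround t ht x).2.2.1⟩) hshi

/-- **Hamilton's convergence criterion 5.2 in dimension four HOLDS** — the tree's bespoke named fact
`Literature.Geometry.Riemannian.hamilton_convergenceCriterion_four` (Hamilton 1986, §5, 5.2, vended form:
along every Ricci flow from `g₀` the blocks stay in `{m ≤ tr A + tr C} ∩ {|M̊|² ≤ K (tr A + tr C)^{2−τ}}`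
⇒ `M` carries a `C^∞` Riemannian metric of constant sectional curvature `k > 0`) is PROVED: reduce the exponent
to `τ' = min τ 1 ≤ 1` (`mem_pinchingSet_of_hamiltonSet`, p113080) and run `constantCurvature_of_pinchedFlows_rails`.
This is also hypothesis `h₁` of the tree's reduction of Hamilton's 1986 classification of closed 4-manifolds with
positive curvature operator (`HamiltonPCOClassificationProofs.lean`).
[cite: Hamilton1986, §5, 5.2 Convergence criterion (p. 164)] [cite: Hamilton1982, §§11–17] -/
theorem hamilton_convergenceCriterion_four_holds : hamilton_convergenceCriterion_four := by
  intro M _ _ _ _ _ _ _ g₀ m K τ hg₀ hm hK hτ hflows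
  refine constantCurvature_of_pinchedFlows_rails M g₀ m (K * m ^ (min τ 1 - τ) * m ^ (-min τ 1))
    (K * m ^ (min τ 1 - τ)) (min τ 1) hg₀ hm (mul_pos hK (Real.rpow_pos_of_pos hm _))
    (lt_min hτ one_pos) (min_le_right τ 1) fun T g cov hflow hR h0 t ht x e he ↦ ?_
  haveI := (g t).hasLeviCivita
  exact mem_pinchingSet_of_hamiltonSet (hflow.isLeviCivita t ht) hm hK.le hτ e
    (hflows T g cov hflow hR h0 t ht x e he)

/-! ## The crux modulo the TWO Gursky–Viaclovsky facts -/

/-- **The crux `EntropyRung.ChangGurskyYang` from its TWO remaining one-fact leaves** — Gursky–Viaclovsky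
openness and closedness of the solvable set along the Weyl-weighted `σ₂` path (GV 2003, Prop. 2 + §5:
Schauder/implicit function theorem, resp. Evans–Krylov/Arzelà–Ascoli): Chern–Gauss–Bonnet is
`chernGaussBonnet_four_holds`, CGY Thm. 1.4 is `changGurskyYang_theorem14_four_of_twoGvFacts` (GV `C¹`/`C²`
estimates being theorems of the tree), and Hamilton's convergence criterion is `hamilton_convergenceCriterion_four_holds`
above; composition `ChangGurskyYang_of_classicalFacts` (p88196).
[cite: ChangGurskyYang2003, Thm. A and §2, p. 121] [cite: GurskyViaclovsky2003, Prop. 2 and §5] -/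
theorem ChangGurskyYang_of_twoFacts :
    gurskyViaclovsky_pathOpen_weighted_four → gurskyViaclovsky_pathClosed_weighted_four → ChangGurskyYang :=
  fun hO hC ↦ ChangGurskyYang_of_classicalFacts chernGaussBonnet_four_holds
    (changGurskyYang_theorem14_four_of_twoGvFacts hO hC) hamilton_convergenceCriterion_four_holds

/-- The same for the item's second route decl `WeylBudget.ChangGurskyYang` (the same proposition).
[cite: ChangGurskyYang2003, Thm. A] -/
theorem ChangGurskyYang_weylBudget_of_twoFacts :
    gurskyViaclovsky_pathOpen_weighted_four → gurskyViaclovsky_pathClosed_weighted_four →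
      Summit.SmoothPoincare4.SmoothPoincare4.Theses.WeylBudget.ChangGurskyYang :=
  ChangGurskyYang_of_twoFacts

/-- **The Literature named fact `changGurskyYang_sphere_four` (CGY 2003 Thm. A, simply connected `R > 0`
case) from the two Gursky–Viaclovsky facts** (the crux is that fact verbatim). [cite: ChangGurskyYang2003, Thm. A] -/
theorem changGurskyYang_sphere_four_of_twoFacts :
    gurskyViaclovsky_pathOpen_weighted_four → gurskyViaclovsky_pathClosed_weighted_four →
    changGurskyYang_sphere_four :=
  ChangGurskyYang_of_twoFacts

end Summit.SmoothPoincare4.SmoothPoincare4.Theorems.MargerinRails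

end
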